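import Summits.ValiantsHypothesis.ValiantsHypothesis.Theorems.BarrierLeverAnchoredDoorHitsLowerPairsRouting
import Summits.ValiantsHypothesis.ValiantsHypothesis.Theorems.BarrierLeverAnchoredDoorHitsLowerPairsSwap
import Summits.ValiantsHypothesis.ValiantsHypothesis.Theorems.BarrierLeverAnchoredDoorHitsLowerPairsMono

/-!
# Support item `AnchoredDoorHitsLowerPairs` (stmt-ValiantsHypothesis-22510), line `anchored-peeling`:
# the ROUTING CONJECTURE as a typed stub, and its transfer to the line

Helper file (`--supports stmt-ValiantsHypothesis-22510`; cell valiant-natproofs, rung V4, 𝒟-side door (c); registered line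
`Cruxes/AnchoredDoorHitsLowerPairs/Lines/anchored_peeling.lean` v5; prover seat val-np-p1 gen 17). One `def … : Prop` (the stub
text, OFFERED to the planner for registration under D-0145 — it elaborates over tree declarations only) and its landed transfer.
Closes NO item; the conjecture is NOT asserted.

* `Stmt.stub_routing` — **ROUTING CONJECTURE** (memo HOME/val-np-p1/g17/DTPEEL-MEMO-valnp1-g17.md §3–§6): every pair of injective
  simplicial-complex layouts `(u, w)` (lower row and column families, any `h`, any `r`) admits, on the `x`-side OR on the `y`-side, a
  valid schedule of DT-peel stages (`DTPeel.Stage`, `DTPeel.ValidSched`, file `…Routing`) that turns the rows into unit rows forming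
  a permutation of the columns. Purely combinatorial (finite data per instance, checkable by `decide`); exhaustive search finds one
  for every pair on `≤ 4 × 4` vertices and for `> 30 000` further pairs (all `R` on `5..7` vertices with `|R| ≤ 8` against every
  `C` on `3` vertices; all `R` on `5` vertices with `|R| ≤ 11` against every `C` on `4` vertices; cube/ball `k = 2`, `P_3`, `K_5/K_{1,7}`,
  `C_6`/sun, …); no counterexample known. CHEAPEST FALSIFIER: a lower pair with no routing on either side (lab/broute.py, seconds
  per pair at `h ≤ 6`).
* `stub_symbolicNonvanishing_of_routing : Stmt.stub_routing → Stmt.stub_symbolicNonvanishing` (`s := 1`, `h₀ := 0`), via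
  `DTPeel.symbolicDet_ne_zero_of_routing` (p595531) and the row/column symmetry `symbolicDet_ne_zero_comm` (p4's `…Swap`); and
  the any-profile form `symbolicDet_ne_zero_of_routing_stub` (`…Mono`). With the skeleton's `stub_genericPoint` this is an
  ALTERNATIVE sufficient condition for the item, beside `stub_rigidPairs` and `stub_vertexStep`.

WHAT THIS IS NOT: no claim that the conjecture holds; nothing on crux stmt-ValiantsHypothesis-14610 or on `VP` versus `VNP`.
-/

set_option linter.dupNamespace false

namespace Summit.ValiantsHypothesis.ValiantsHypothesis.Theorems.BarrierLever.AnchoredPeeling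

open Finset MvPolynomial

noncomputable section

/-- An `x`-side routing of the layout `(u, w)`: a valid schedule of DT-peel stages turning the rows `(u i | ∅)` into unit rows
`(∅ | w (π i))` for a permutation `π`. -/
def DTPeel.HasRouting {h r : ℕ} (u w : Fin r → Finset (Fin h)) : Prop :=
  ∃ (L : List (DTPeel.Stage h r)) (π : Equiv.Perm (Fin r)),
    DTPeel.ValidSched L u (fun _ => ∅) ∧ (∀ i, DTPeel.runU L u i = ∅) ∧ ∀ i, DTPeel.runE L u (fun _ => ∅) i = w (π i)

/-- **STUB (ROUTING CONJECTURE).** Every injective simplicial-complex pair has a routing on the `x`-side or on the `y`-side. -/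
def Stmt.stub_routing : Prop :=
  ∀ (h r : ℕ) (u w : Fin r → Finset (Fin h)), Function.Injective u → Function.Injective w →
    IsLowerSet (Set.range u) → IsLowerSet (Set.range w) →
    DTPeel.HasRouting u w ∨ DTPeel.HasRouting w u

/-- **Transfer.** A routing (either side) gives profile-1 symbolic non-vanishing. -/
theorem symbolicDet_one_ne_zero_of_hasRouting {h r : ℕ} (u w : Fin r → Finset (Fin h))
    (hu : Function.Injective u) (hw : Function.Injective w)
    (H : DTPeel.HasRouting u w ∨ DTPeel.HasRouting w u) : symbolicDet 1 h r u w ≠ 0 := by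
  rcases H with ⟨L, π, hv, hU, hE⟩ | ⟨L, π, hv, hU, hE⟩
  · exact DTPeel.symbolicDet_ne_zero_of_routing le_rfl u w hw L hv hU π hE
  · exact (symbolicDet_ne_zero_comm 1 h r u w).mpr (DTPeel.symbolicDet_ne_zero_of_routing le_rfl w u hu L hv hU π hE)

/-- **The routing conjecture implies the line's symbolic non-vanishing stub** (`s := 1`, `h₀ := 0`). -/
theorem stub_symbolicNonvanishing_of_routing (H : Stmt.stub_routing) : Stmt.stub_symbolicNonvanishing :=
  ⟨1, 0, fun h _ r u w hu hw hlu hlw => symbolicDet_one_ne_zero_of_hasRouting u w hu hw (H h r u w hu hw hlu hlw)⟩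

/-- The same at any profile `s ≥ 1`. -/
theorem symbolicDet_ne_zero_of_routing_stub (H : Stmt.stub_routing) {s : ℕ} (hs : 1 ≤ s) (h r : ℕ)
    (u w : Fin r → Finset (Fin h)) (hu : Function.Injective u) (hw : Function.Injective w)
    (hlu : IsLowerSet (Set.range u)) (hlw : IsLowerSet (Set.range w)) : symbolicDet s h r u w ≠ 0 :=
  symbolicDet_ne_zero_mono hs (symbolicDet_one_ne_zero_of_hasRouting u w hu hw (H h r u w hu hw hlu hlw))

/-- Hence also an anchored hit at every profile `s ≥ 1` (the landed `stub_genericPoint`). -/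
theorem anchoredHit_of_routing_stub (H : Stmt.stub_routing) {s : ℕ} (hs : 1 ≤ s) (h r : ℕ)
    (u w : Fin r → Finset (Fin h)) (hu : Function.Injective u) (hw : Function.Injective w)
    (hlu : IsLowerSet (Set.range u)) (hlw : IsLowerSet (Set.range w)) : AnchoredHit s h r u w :=
  stub_genericPoint s h r u w (symbolicDet_ne_zero_of_routing_stub H hs h r u w hu hw hlu hlw)

end

end Summit.ValiantsHypothesis.ValiantsHypothesis.Theorems.BarrierLever.AnchoredPeeling
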